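import Literature.Analysis.FluidPDE.SteadyLiouvilleCriteriaProofs
import Literature.Analysis.FluidPDE.NormalisedPressureLpClass
import HarnessLib

/-!
# C177 `Wu2026` — toward `Step_341` (§3.3): the harmonic normalisation of the pressure,
# `p − p̃[v] ≡ const` for a steady profile with `v ∈ L^{15/2}(ℝ³)`

Seat `ns-in-wu-341` (D-0154 (2) INPUTS, director-ns req136; A3 Wu 2026, KEY `Step_341`), filed in the
salvage namespace `…Theorems.Wu2026Salvage` (conventions of the `SoloSalvageWu2026*` files: theorems
only, standard axioms, no definition, no named fact).

The printed step (arXiv:2608.22471v1, §3.3 p.14 l.29–43): «Define the canonical pressure by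
p_can := R_iR_k(v_iv_k). … ∇p = ∇p_can in distributions. Thus the original pressure and p_can differ
only by one constant.» In the tree the canonical (Riesz-transform) pressure is
`Literature.Analysis.FluidPDE.normalisedPressure v` (`p̃[v] = −|v|²/3 + p.v.∫K(x−y)(v(y))dy`,
`Δp̃[v] = −∂ᵢ∂ⱼ(vᵢvⱼ)`), with its Calderón–Zygmund theory on the Lebesgue class `v ∈ L^{2q}`
(`NormalisedPressureLpClass`: measurability, Stein's bound, the weak pressure Poisson equation).

What is proved here (no boundedness, decay or Dirichlet-energy hypothesis is used — only the profile
equations and the integrability exponents):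

* `exists_pressure_sub_ae_eq_const` — for a Leray profile `(U, P)` (`IsLerayProfile ν a U P`) with
  `∫|U|^{15/2} < ∞` and a measurable `Q` with `∫|Q|^{15/4} < ∞` solving `∫ Q Δφ = −∫ D²φ(U,U)` for all
  test `φ`, `P − Q` is a.e. constant. Proof = the tree's fixed-scale Liouville estimate
  `IsLerayProfile.abs_fderiv_normed_convolution_sub_le` (Tsai 1998, Lemma 2.1; NRŠ 1996, Lemma 3.1)
  fed with the three ball bounds `∫_{B_ϱ}|U| ≲ ϱ^{13/5}`, `∫_{B_ϱ}|U|² ≲ ϱ^{11/5}`,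
  `∫_{B_ϱ}|Q| ≲ ϱ^{11/5}`, ALL by Hölder on balls (`setIntegral_norm_closedBall_le_holder` with the
  pairs `(15/2, 15/13)`, `(15/4, 15/11)`, `(15/4, 15/11)`), then `R → ∞`; every mollification of
  `P − Q` has zero gradient and the mollifications converge a.e. (pattern of the tree's
  `IsLerayProfile.exists_sub_ae_eq_const_nineHalves`, which is the case `U ∈ L^{9/2} ∩ L^∞`,
  `Q ∈ L^{9/4}` — not applicable to Wu's flows, which are only WEAK-`L^{9/2}`).
* `exists_pressure_sub_normalisedPressure_ae_eq_const` — the case `Q = p̃[U]` for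
  `U ∈ L^{2·(15/4)} = L^{15/2}`: `∃ c, P − p̃[U] = c` a.e. (Stein's bound at exponent `15/4` and the
  weak Poisson equation on the class, `integral_normalisedPressure_mul_laplacian_of_memLp`).

The exponent `15/2` is the one the tree's estimate is written for; any `U ∈ L^{9/2,∞} ∩ L^∞` (the
flows of `IsWuFlow` with Lemma 2.1) lies in `L^{15/2}` (`MemWeakLp.memLp_of_norm_le`), which is how
`Step_341` consumes this file.

WHAT THIS IS NOT: not a claim about NS regularity or blow-up; not a claim about any author beyond the
typed locator; a printed step is being re-proved as typed.
-/

noncomputable section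

set_option linter.dupNamespace false

open MeasureTheory Set Function Filter Topology Metric ContinuousLinearMap
open scoped ENNReal NNReal RealInnerProductSpace ContDiff Laplacian Convolution

namespace Summit.NavierStokesRegularity.NavierStokesRegularity.Theorems.Wu2026Salvage

open Literature.Analysis.FluidPDE Literature.Analysis.FunctionSpaces

variable {ν a : ℝ} {U : EuclideanSpace ℝ (Fin 3) → EuclideanSpace ℝ (Fin 3)}
  {P : EuclideanSpace ℝ (Fin 3) → ℝ}

/-- `‖(‖U x‖²)‖ₑ^{15/4} = ‖U x‖ₑ^{15/2}`. [folklore] -/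
theorem enorm_norm_sq_rpow_fifteen_fourths (U : EuclideanSpace ℝ (Fin 3) → EuclideanSpace ℝ (Fin 3))
    (x : EuclideanSpace ℝ (Fin 3)) :
    ‖(‖U x‖ ^ 2)‖ₑ ^ (15 / 4 : ℝ) = ‖U x‖ₑ ^ (15 / 2 : ℝ) := by
  rw [Real.enorm_eq_ofReal (sq_nonneg _), ENNReal.ofReal_pow (norm_nonneg _), ofReal_norm,
    ← ENNReal.rpow_natCast, ← ENNReal.rpow_mul]
  norm_num

/-- **Mollifications of `P − Q` have zero gradient** for a Leray profile `(U, P)` with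
`∫ |U|^{15/2} < ∞` and a measurable `Q` with `∫ |Q|^{15/4} < ∞` solving the pressure Poisson equation
`∫ Q Δφ = −∫ D²φ(U, U)` weakly: the fixed-scale estimate
`IsLerayProfile.abs_fderiv_normed_convolution_sub_le` with the Hölder ball bounds
`∫_{B_ϱ}|U| ≲ ϱ^{13/5}`, `∫_{B_ϱ}|U|² ≲ ϱ^{11/5}`, `∫_{B_ϱ}|Q| ≲ ϱ^{11/5}`, and `R → ∞`.
[cite: Wu2026, §3.3 p.14 l.29–43; Tsai1998, Lemma 2.1 (pp. 35–36)] -/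
theorem fderiv_normed_convolution_pressure_sub_eq_zero (hprof : IsLerayProfile ν a U P)
    (hIU : ∫⁻ y, ‖U y‖ₑ ^ (15 / 2 : ℝ) ≠ ⊤)
    {Q : EuclideanSpace ℝ (Fin 3) → ℝ} (hQm : AEStronglyMeasurable Q volume)
    (hIQ : ∫⁻ y, ‖Q y‖ₑ ^ (15 / 4 : ℝ) ≠ ⊤)
    (hQ : ∀ φ : EuclideanSpace ℝ (Fin 3) → ℝ, ContDiff ℝ (⊤ : ℕ∞) φ → HasCompactSupport φ →
      ∫ y, Q y * (Δ φ) y = -∫ y, fderiv ℝ (fderiv ℝ φ) y (U y) (U y))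
    (ψ : ContDiffBump (0 : EuclideanSpace ℝ (Fin 3))) (y e : EuclideanSpace ℝ (Fin 3)) :
    fderiv ℝ (ψ.normed volume ⋆[lsmul ℝ ℝ, volume] fun x => P x - Q x) y e = 0 := by
  -- exponents and basic regularity
  have hpq₁ : (15 / 2 : ℝ).HolderConjugate (15 / 13) := ⟨by norm_num, by norm_num, by norm_num⟩
  have hpq₂ : (15 / 4 : ℝ).HolderConjugate (15 / 11) := ⟨by norm_num, by norm_num, by norm_num⟩
  have hU1 : ContDiff ℝ 1 U := hprof.contDiff_velocity.of_le one_le_two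
  have hP1 := hprof.contDiff_pressure
  have hUm : AEStronglyMeasurable U volume := hU1.continuous.aestronglyMeasurable
  have hU2m : AEStronglyMeasurable (fun x => ‖U x‖ ^ 2) volume :=
    (hU1.continuous.norm.pow 2).aestronglyMeasurable
  have hIU2 : ∫⁻ x, ‖(‖U x‖ ^ 2)‖ₑ ^ (15 / 4 : ℝ) ≠ ⊤ := by
    simp_rw [enorm_norm_sq_rpow_fifteen_fourths]
    exact hIU
  -- the ball bounds for `U`, `|U|²` and `Q` (Hölder)
  have hballU : ∀ ϱ : ℝ, 0 < ϱ →
      IntegrableOn U (closedBall (0 : EuclideanSpace ℝ (Fin 3)) ϱ) ∧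
      ∫ x in closedBall (0 : EuclideanSpace ℝ (Fin 3)) ϱ, ‖U x‖ ≤
        ((∫⁻ x, ‖U x‖ₑ ^ (15 / 2 : ℝ)) ^ (1 / (15 / 2 : ℝ)) *
          volume (ball (0 : EuclideanSpace ℝ (Fin 3)) 1) ^ (1 / (15 / 13 : ℝ))).toReal *
          ϱ ^ (13 / 5 : ℝ) := fun ϱ hϱ => by
    have h := setIntegral_norm_closedBall_le_holder hUm hpq₁ hIU hϱ
    exact ⟨h.1, h.2.trans_eq (by norm_num)⟩
  have hballU2 : ∀ ϱ : ℝ, 0 < ϱ →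
      IntegrableOn (fun x => ‖U x‖ ^ 2) (closedBall (0 : EuclideanSpace ℝ (Fin 3)) ϱ) ∧
      ∫ x in closedBall (0 : EuclideanSpace ℝ (Fin 3)) ϱ, ‖(‖U x‖ ^ 2)‖ ≤
        ((∫⁻ x, ‖(‖U x‖ ^ 2)‖ₑ ^ (15 / 4 : ℝ)) ^ (1 / (15 / 4 : ℝ)) *
          volume (ball (0 : EuclideanSpace ℝ (Fin 3)) 1) ^ (1 / (15 / 11 : ℝ))).toReal *
          ϱ ^ (11 / 5 : ℝ) := fun ϱ hϱ => by
    have h := setIntegral_norm_closedBall_le_holder hU2m hpq₂ hIU2 hϱ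
    exact ⟨h.1, h.2.trans_eq (by norm_num)⟩
  have hballQ : ∀ ϱ : ℝ, 0 < ϱ →
      IntegrableOn Q (closedBall (0 : EuclideanSpace ℝ (Fin 3)) ϱ) ∧
      ∫ x in closedBall (0 : EuclideanSpace ℝ (Fin 3)) ϱ, ‖Q x‖ ≤
        ((∫⁻ x, ‖Q x‖ₑ ^ (15 / 4 : ℝ)) ^ (1 / (15 / 4 : ℝ)) *
          volume (ball (0 : EuclideanSpace ℝ (Fin 3)) 1) ^ (1 / (15 / 11 : ℝ))).toReal *
          ϱ ^ (11 / 5 : ℝ) := fun ϱ hϱ => by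
    have h := setIntegral_norm_closedBall_le_holder hQm hpq₂ hIQ hϱ
    exact ⟨h.1, h.2.trans_eq (by norm_num)⟩
  -- `P - Q` is weakly harmonic
  have hQl : LocallyIntegrable Q volume := locallyIntegrable_of_holder hQm hpq₂ hIQ
  have hharm : ∀ φ : EuclideanSpace ℝ (Fin 3) → ℝ, ContDiff ℝ (⊤ : ℕ∞) φ → HasCompactSupport φ →
      ∫ x, (P x - Q x) * (Δ φ) x = 0 := by
    intro φ hφ hφc
    have hΔc : Continuous (Δ φ) := Literature.Analysis.FluidPDE.continuous_laplacian (contDiff_infty.1 hφ 2)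
    have hΔs : HasCompactSupport (Δ φ) :=
      hφc.mono' fun x hx => by
        contrapose! hx
        simp [Literature.Analysis.FluidPDE.laplacian_eq_zero_of_notMem_tsupport hx]
    have i1 : Integrable fun x => P x * (Δ φ) x :=
      (hP1.continuous.mul hΔc).integrable_of_hasCompactSupport hΔs.mul_left
    have i2 : Integrable fun x => Q x * (Δ φ) x := by
      simpa only [smul_eq_mul] using hQl.integrable_smul_right_of_hasCompactSupport hΔc hΔs
    simp_rw [sub_mul]
    rw [integral_sub i1 i2, hprof.integral_pressure_mul_laplacian_eq_neg_integral_hessian hφ hφc,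
      hQ φ hφ hφc, sub_self]
  -- constants and the fixed-scale estimate
  obtain ⟨⟨C₁, hC₁⟩, ⟨C₂, hC₂⟩⟩ := exists_bound_baseBump_derivs (E := (EuclideanSpace ℝ (Fin 3)))
  have hC₁0 : 0 ≤ C₁ := (norm_nonneg _).trans (hC₁ 0)
  have hC₂0 : 0 ≤ C₂ := (abs_nonneg _).trans (hC₂ 0)
  obtain ⟨K', hK'⟩ : ∃ K' : ℝ, ∀ R : ℝ, 1 ≤ R →
      |fderiv ℝ (ψ.normed volume ⋆[lsmul ℝ ℝ, volume] fun x => P x - Q x) y e| ≤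
        K' * R ^ (-(2 / 5) : ℝ) :=
    ⟨_, fun R hR => hprof.abs_fderiv_normed_convolution_sub_le hQl hharm ENNReal.toReal_nonneg
      ENNReal.toReal_nonneg ENNReal.toReal_nonneg hballU hballU2 hballQ hC₁ hC₂ hC₁0 hC₂0 ψ y e hR⟩
  -- let `R → ∞`
  have hlim : Tendsto (fun R : ℝ => K' * R ^ (-(2 / 5) : ℝ)) atTop (𝓝 0) := by
    simpa using (tendsto_rpow_neg_atTop (by norm_num : (0 : ℝ) < 2 / 5)).const_mul K'
  have hle : |fderiv ℝ (ψ.normed volume ⋆[lsmul ℝ ℝ, volume] fun x => P x - Q x) y e| ≤ 0 :=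
    ge_of_tendsto hlim (eventually_atTop.2 ⟨1, fun R hR => hK' R hR⟩)
  exact abs_nonpos_iff.1 hle

/-- **`P − Q` is a.e. constant** for a Leray profile `(U, P)` with `∫ |U|^{15/2} < ∞` and a
measurable `Q` with `∫ |Q|^{15/4} < ∞` solving the pressure Poisson equation weakly: every
mollification of `P − Q` has zero gradient, hence is constant, and the mollifications converge to
`P − Q` a.e. (Wu 2026, §3.3 p.14 l.40–43 «∇p = ∇p_can in distributions. Thus the original pressure and
p_can differ only by one constant»; argument of NRŠ 1996, Lemma 3.1 / Tsai 1998, Lemma 2.1).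
[cite: Wu2026, §3.3 p.14 l.40–43; NecasRuzickaSverak1996, Lemma 3.1 (p. 287)] -/
theorem exists_pressure_sub_ae_eq_const (hprof : IsLerayProfile ν a U P)
    (hIU : ∫⁻ y, ‖U y‖ₑ ^ (15 / 2 : ℝ) ≠ ⊤)
    {Q : EuclideanSpace ℝ (Fin 3) → ℝ} (hQm : AEStronglyMeasurable Q volume)
    (hIQ : ∫⁻ y, ‖Q y‖ₑ ^ (15 / 4 : ℝ) ≠ ⊤)
    (hQ : ∀ φ : EuclideanSpace ℝ (Fin 3) → ℝ, ContDiff ℝ (⊤ : ℕ∞) φ → HasCompactSupport φ →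
      ∫ y, Q y * (Δ φ) y = -∫ y, fderiv ℝ (fderiv ℝ φ) y (U y) (U y)) :
    ∃ c : ℝ, ∀ᵐ x ∂(volume : Measure (EuclideanSpace ℝ (Fin 3))), P x - Q x = c := by
  have hpq₂ : (15 / 4 : ℝ).HolderConjugate (15 / 11) := ⟨by norm_num, by norm_num, by norm_num⟩
  have hQl : LocallyIntegrable Q volume := locallyIntegrable_of_holder hQm hpq₂ hIQ
  set g : EuclideanSpace ℝ (Fin 3) → ℝ := fun x => P x - Q x with hg_def
  have hgl : LocallyIntegrable g volume :=
    hprof.contDiff_pressure.continuous.locallyIntegrable.sub hQl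
  obtain ⟨φ, hφ0, hφ2⟩ := Literature.Analysis.FunctionSpaces.exists_contDiffBump_seq (E := (EuclideanSpace ℝ (Fin 3)))
  -- each mollification is constant
  have hconst : ∀ k x, ((φ k).normed volume ⋆[lsmul ℝ ℝ, volume] g) x =
      ((φ k).normed volume ⋆[lsmul ℝ ℝ, volume] g) 0 := by
    intro k x
    have hdiff : Differentiable ℝ ((φ k).normed volume ⋆[lsmul ℝ ℝ, volume] g) :=
      ((φ k).hasCompactSupport_normed.contDiff_convolution_left _
        ((φ k).contDiff_normed (n := 1)) hgl).differentiable one_ne_zero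
    have hzero : ∀ y, fderiv ℝ ((φ k).normed volume ⋆[lsmul ℝ ℝ, volume] g) y = 0 := fun y => by
      ext e
      exact fderiv_normed_convolution_pressure_sub_eq_zero hprof hIU hQm hIQ hQ (φ k) y e
    exact is_const_of_fderiv_eq_zero hdiff hzero x 0
  have hlim := Literature.Analysis.FunctionSpaces.ae_tendsto_normed_convolution hφ0 hφ2 hgl
  refine ⟨limUnder atTop fun k => ((φ k).normed volume ⋆[lsmul ℝ ℝ, volume] g) 0, ?_⟩
  filter_upwards [hlim] with x hx
  simp_rw [hconst _ x] at hx
  exact hx.limUnder_eq.symm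

/-- **The pressure of a steady profile is the canonical (Riesz-transform) pressure up to a
constant** when `U ∈ L^{15/2}(ℝ³)` (written `L^{2·(15/4)}` for the tree's `L^{2q} → L^q` lemmas):
`∃ c, P − p̃[U] = c` a.e., `p̃ = normalisedPressure` (Stein's bound at exponent `15/4`,
`memLp_normalisedPressure_of_memLp_two_mul`, and the weak pressure Poisson equation on the class,
`integral_normalisedPressure_mul_laplacian_of_memLp`). This is Wu 2026, (3.36): «After changing the
original pressure by this constant, we write from now on p = p_can = R_iR_k(v_iv_k)».
[cite: Wu2026, (3.36) p.14 l.29–45] -/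
theorem exists_pressure_sub_normalisedPressure_ae_eq_const (hprof : IsLerayProfile ν a U P)
    (hU : MemLp U (2 * (15 / 4 : ℝ≥0∞)) volume) :
    ∃ c : ℝ, ∀ᵐ x ∂(volume : Measure (EuclideanSpace ℝ (Fin 3))),
      P x - normalisedPressure U x = c := by
  have hp1 : (1 : ℝ≥0∞) < 15 / 4 := by
    rw [ENNReal.lt_div_iff_mul_lt (Or.inl (by norm_num)) (Or.inl (by norm_num))]
    norm_num
  have hp2 : (15 / 4 : ℝ≥0∞) < ⊤ := ENNReal.div_lt_top (by norm_num) (by norm_num)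
  have h2p0 : (2 * (15 / 4 : ℝ≥0∞)) ≠ 0 := mul_ne_zero two_ne_zero hp1.ne_bot
  have h2pt : (2 * (15 / 4 : ℝ≥0∞)) ≠ ⊤ := ENNReal.mul_ne_top ENNReal.ofNat_ne_top hp2.ne
  have h2pr : (2 * (15 / 4 : ℝ≥0∞)).toReal = 15 / 2 := by
    rw [ENNReal.toReal_mul, ENNReal.toReal_div]
    norm_num
  have hpr : (15 / 4 : ℝ≥0∞).toReal = 15 / 4 := by
    rw [ENNReal.toReal_div]
    norm_num
  -- `U ∈ L^{15/2}` as a finite `lintegral`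
  have hIU : ∫⁻ y, ‖U y‖ₑ ^ (15 / 2 : ℝ) ≠ ⊤ := by
    rw [← h2pr]
    exact (lintegral_rpow_enorm_lt_top_of_eLpNorm_lt_top h2p0 h2pt hU.eLpNorm_lt_top).ne
  -- `Q = p̃[U] ∈ L^{15/4}`, measurable, with the weak Poisson equation
  have hQ : MemLp (normalisedPressure U) (15 / 4 : ℝ≥0∞) volume :=
    memLp_normalisedPressure_of_memLp_two_mul hp1 hp2 hU
  have hIQ : ∫⁻ y, ‖normalisedPressure U y‖ₑ ^ (15 / 4 : ℝ) ≠ ⊤ := by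
    rw [← hpr]
    exact (lintegral_rpow_enorm_lt_top_of_eLpNorm_lt_top hp1.ne_bot hp2.ne hQ.eLpNorm_lt_top).ne
  have hPoisson : ∀ φ : EuclideanSpace ℝ (Fin 3) → ℝ, ContDiff ℝ (⊤ : ℕ∞) φ → HasCompactSupport φ →
      ∫ y, normalisedPressure U y * (Δ φ) y = -∫ y, fderiv ℝ (fderiv ℝ φ) y (U y) (U y) :=
    fun φ hφ hφc => integral_normalisedPressure_mul_laplacian_of_memLp hp1 hp2 hU hφ hφc
  exact exists_pressure_sub_ae_eq_const hprof hIU hQ.1 hIQ hPoisson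

end Summit.NavierStokesRegularity.NavierStokesRegularity.Theorems.Wu2026Salvage

end

-- WHAT THIS IS NOT: not a claim about NS regularity or blow-up; not a claim about any author beyond the typed locator.
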